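import Summits.QuantumFields.YangMills.Theorems.BalabanUVNodesN17KeyedRatesContent
import Literature.MathematicalPhysics.QuantumFieldTheory.Balaban1983to89.Node00.Record13SepCoPH

/-!
# BalabanUVNodes ∕ node N17 = NE4 — THE K3⁷ v1 STUB `stub_rates13` FROM N17's SCALE-SHIFT SENTENCE FOR β₁₃ (the plan's BOOKING RULE, in the kernel)

Cell `pub-ymgap` (HUMAN RULINGS D-0062 ∕ D-0149), WIDTH SEAT `pub-ymgap-dag-n17-w1` (seat 1 of 3 on NODE n17), generation 0; W-SEAT-START-LIST v3 (plan g77) §2 n17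
ITEM 1 «the v1-stub-1 BOOKABLE sentence».  THEOREMS ONLY (0 `def`, 0 `sorry`); filed `--kind proof --supports stmt-QuantumFields-20544 --as helper` (K3⁷
`SpineGivenEndpointR13SepCoPH`, dag-lead WORDS-143); COUNT-NEUTRAL; NO Theses import, NO import of the skeleton.

WHAT THIS FILE IS.  The K3⁷ skeleton OF RECORD (`K3Skeleton13SepCoPH.lean`, sha16 136533349746421b, registered on stmt-QuantumFields-20544, plan g73∕g77) has
the registered stub

  `stub_rates13 : ∃ rr : RateReading 2, KeyedRates rr ∧ KeyedWindow rr`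

with the skeleton-local shapes (its §1; NOT tree declarations)
* `RateReading N := (F : T4Family) → (θ : Stage13HParams F N) → θ.Provisos₁₃SepCoPH F N → (ℕ → ℝ) → List (ULoop F) → RateCarriers N`,
* `KeyedRates rr := ∀ F θ hP, θ.Admissible F N → ∀ g₀ os, RatesAt (datumOfRecord₁₃SepCoPH F N θ hP) (rr F θ hP g₀ os)`,
* `KeyedWindow rr := ∀ F θ hP g₀ os, (rr F θ hP g₀ os).u3.γ = θ.γ`.

They are written out UNFOLDED below (at the tree's generality `N`, then at `N = 2`), so that the K3⁷ line closes `stub_rates13` BY NAME + SIGNATURE with ONE `exact`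
(delta) from this file's headline once its hypothesis is supplied.  The plan's BOOKING RULE (W-SEAT-START-LIST §0, plan g77 STATE+CLOSE l.24046: «a by-name close of
`stub_rates13` = N17's scale-shift sentence only») is made a KERNEL `iff` at the ⁷ keys:

* §1 `exists_keyedRatesWindow₁₃SepCoPH_iff_n17Free` (N-generic): the literal shape of `stub_rates13` ⟺ «N17 WITH FREE LETTERS AT THE ⁷ RECORD»
  `∀ F (θ : Stage13HParams F N) (hP : θ.Provisos₁₃SepCoPH F N), θ.Admissible F N → ∃ c ρ, NE4OnData (datumOfRecord₁₃SepCoPH F N θ hP) c ρ θ.γ` — the ⁷ image (token map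
  T₆∘T₇ of the skeleton's own header: `Stage12∕13Params ↦ Stage13HParams`, `Provisos ↦ Provisos₁₃SepCoPH`, `datumOfRecord ↦ datumOfRecord₁₃SepCoPH`) of companion 17's
  `exists_keyedRatesWindow₁₂_iff_n17Free` (`…N17KeyedRatesContent`, p471043), proved from that module's STAGE-FREE one-bundle lemma `exists_ratesAt_window_iff_n17Free`
  BY NAME (not restated): (→) read the N17 conjunct at `(g₀, os) := (0, [])`; (←) per tuple, the LETTER-DEGENERATE bundle of `ratesAt_degenerate_iff` (empty dressed tower,
  empty paired-instance index, `dom = ∅`, EMPTY coupling window with ZERO functionals and zero moduli) — DISPLAYED AS SUCH: the five letters N14 ∕ N15 ∕ N16 ∕ N18 ∕ N22 of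
  the v1 stub are IDLE (dag-n18-e's LOCATED evidence #5 `K3Stub1ShadowSepCoPH.lean` 9f8e44bee6b50d53 on 20544 says the same with its own junk carriers; here in the tree, at ⁷).
* §2 in β-OF-RECORD words: `NE4OnData (datumOfRecord₁₃SepCoPH F N θ hP) c ρ γ ↔ ScaleShiftRate c ρ γ (betaOfRecord₁₃ F N θ.toStage13Params)` (`Iff.rfl` through def-T's face
  `Node00.βfun_datumOfRecord₁₃SepCoPH`, FILE 28T p539169) — the ⁷ provisos `hP` and the history-indexed slots `Zh ∕ Phih` are NOT READ by N17 (β₁₃ is a function of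
  `θ.toStage13Params`); hence `n17Free₁₃SepCoPH_of_stage13`: the PROVISO-FREE ‴ sentence over `Stage13Params` already gives the ⁷ one.
* §3 THE HEADLINE at `N = 2` in the plan's words: **`stub_rates13_of_scaleShift`** — «∀ admissible ⁷ tuples, ∃ c ρ, `ScaleShiftRate c ρ θ.γ (betaOfRecord₁₃ F 2 θ.toStage13Params)`»
  (ρ UNGUARDED: no `0 ≤ ρ < 1`, no sign of `c`) ⟹ the literal shape of `stub_rates13`; its converse `scaleShift_of_stub_rates13` and the `iff` `stub_rates13_iff_scaleShift`
  (= the booking rule); the instances `stub_rates13_of_bounded_shifts` (`ρ = 1`: BOUNDED β-shifts on the record boxes suffice — evidence #5's shape, now in the tree) and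
  `stub_rates13_of_absBound` (any geometric GROWTH bound `|β_{k+1}| ≤ M·A^k`, `A ≥ 1`, via companion 17's `scaleShiftRate_of_absBound`): free letters buy SIZE, not DECAY.
* §4 THE CoPH-HOME DOOR `exists_keyedRatesWindow₁₃SepCoPH_of_coPH` (N-generic): the same literal shape keyed at def-T's CORE keys (`Provisos₁₃CoPH ∕ datumOfRecord₁₃CoPH` —
  the currency of dag-n22-e's home `…RateCarriersOfRecord13CoPHOn` §5 `exists_keyedRates_window_of_k4_rRec₁₃CoPHOn_true(_glueN17)`) ⟹ the ⁷ (`SepCoPH`) shape, by restriction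
  along `Provisos₁₃SepCoPH.toCore` (`datumOfRecord₁₃SepCoPH_eq_coPH`, `rfl`): the six K4 stubs at a NAMED reading of record also close `stub_rates13` by name — the honest road.

HONEST SCOPE (A6, director-ym №189).  §1∕§3 are CHARACTERISATIONS (`iff`): the hypothesis of the headline — N17's scale-shift sentence for β₁₃ with free letters — is
EXACTLY the registered stub's content, so the headline is vacuous iff the stub is false; that sentence is NE4-shaped and NOT IN PRINT ([Balaban1987RG1] p. 264 «We will
investigate other properties in a separate paper»; p. 298), NOT PROVED here or anywhere in the tree (β₁₃ is built from `Node00.polLimit` = `limUnder` values and `tsum`s: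
no kernel inhabitant, no kernel refutation), and strictly WEAKER than N17 proper (no `ρ < 1`).  The (←) witness reading is LETTER-DEGENERATE and discharges NO node; it is
displayed, not hidden — which is the planners' reason for the v2 re-cut over `RatesHolderAt ∧ ReadOutAt` (draft `D77-K3V2-draft/`, not registered).  Nothing of Bałaban's is
asserted or instantiated; N17 = NE4 is NOT discharged (row n17: DEPENDENT∕DERIVED, composite of N15, N16, (D4)); K3⁷ is neither claimed nor refuted; counts UNMOVED
(typed 28∕28 · discharged 5∕27, A 5∕28).  One finite four-torus programme at fixed `ε = L^{−K}` per run, Bałaban AS PRINTED — the Yang–Mills mass gap (Clay) is NOT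
proved by any of this; R4 closes the conditional finite-𝕋⁴ rung `BalabanLadder.UV` only; nothing continuum ∕ ℝ⁴ ∕ infinite volume ∕ OS ∕ mass gap.

v1.1 (EDITION 2, APPEND-ONLY — §1–§4 byte-identical; same seat, same generation): §5 «WHAT THE WHOLE v1 CUT OBLIGES AT ⁷» — the ⁷ image of companion 17 §F:
`forall_keyedRates₁₃SepCoPH_imp_iff_rateFree` (GIVEN §1's right-hand side, the literal shape of `stub_expansion13` — its three `rr`-free conjuncts as arbitrary predicates
`P₁ P₂ P₃` on spine readings, `KeyedCoreEdge cr rr` written out — ⟺ `∃ cr, P₁ cr ∧ P₂ cr ∧ P₃ cr ∧` the NE7 core two-run matching with some summable `δ` WITH NO RATE ANTECEDENT,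
because the `∀ rr` must serve §1's letter-degenerate reading, at which `RatesAt` is TRUE) and `k3Cut₁₃SepCoPH_iff_n17Free_and_rateFree` (`stub_rates13 ∧ stub_expansion13`, literal
shapes, ⟺ «N17 with free letters at the ⁷ record» ∧ that rate-free package): in the v1 cut the K4 cluster N14 ∕ N15 ∕ N16 ∕ N18 ∕ N22 is IDLE and every rate a `stub_expansion13`
prover could use is erased by the `∀ rr` — kernel evidence for the planners' v1-versus-v2 decision (plan g77 STATE+CLOSE: v2 DRAFT `D77-K3V2-draft/` re-cuts over
`RatesHolderAt ∧ ReadOutAt`; fallback 2026-08-29).  Count-neutral; K3⁷ neither claimed nor refuted.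
-/

namespace Summit.QuantumFields.YangMills.Theorems.BalabanUVNodesK3Stub1OfScaleShift

open Literature.MathematicalPhysics.QuantumFieldTheory.Balaban1983to89
open Literature.MathematicalPhysics.QuantumFieldTheory.Balaban1983to89.FlowStep
open Literature.MathematicalPhysics.QuantumFieldTheory.Balaban1983to89.T4CouplingMatching (ScaleShiftRate)
open Literature.MathematicalPhysics.QuantumFieldTheory.Balaban1983to89.T4Continuum (T4Family FiniteEpsData ULoop)
open Literature.MathematicalPhysics.QuantumFieldTheory.Balaban1983to89.Node00
open Summit.QuantumFields.BalabanUV.T4Continuum.Spine.NE4 (NE4OnData)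
open YMDAG.UVSplit (Datum RateCarriers RatesAt)
open Summit.QuantumFields.YangMills.Theorems.BalabanUVNodesN17 (exists_ratesAt_window_iff_n17Free exists_rateCarriers_window_ratesAt_iff
  scaleShiftRate_of_absBound)

/-! ## §1 The literal shape of `stub_rates13` IS «N17 with free letters at the ⁷ record» (N-generic) -/

section Keyed

variable {N : ℕ} [NeZero N]

/-- **STUB 1 OF K3⁷ v1, READ EXACTLY** (kernel `iff`, general `N`; the skeleton's `∃ rr : RateReading N, KeyedRates rr ∧ KeyedWindow rr` is the left-hand side by
delta): SOME reading of rate carriers off the ⁷ Stage-13 tuples (`Stage13HParams`, provisos `Provisos₁₃SepCoPH`) carries the six rates on the datum of record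
`datumOfRecord₁₃SepCoPH` at every admissible tuple, with the U3 window pinned to `θ.γ` — IFF — at every admissible ⁷ tuple with provisos the datum's β has SOME
scale-shift bound with FREE letters `(c, ρ)` on the record's own window.  (→) evaluate the reading at `(g₀, os) := (0, [])` and project the u3 letters
(`exists_ratesAt_window_iff_n17Free`, mp); (←) choose per tuple the LETTER-DEGENERATE bundle (same lemma, mpr; junk letters off admissibility) — N14 ∕ N15 ∕ N16 ∕ N18 ∕
N22 contribute nothing.  The ⁷ image of companion 17's `exists_keyedRatesWindow₁₂_iff_n17Free`. [bookkeeping] -/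
theorem exists_keyedRatesWindow₁₃SepCoPH_iff_n17Free :
    (∃ rr : (F : T4Family) → (θ : Stage13HParams F N) → θ.Provisos₁₃SepCoPH F N → (ℕ → ℝ) → List (ULoop F) → RateCarriers N,
        (∀ (F : T4Family) (θ : Stage13HParams F N) (hP : θ.Provisos₁₃SepCoPH F N), θ.Admissible F N → ∀ (g₀ : ℕ → ℝ) (os : List (ULoop F)),
            RatesAt (datumOfRecord₁₃SepCoPH F N θ hP) (rr F θ hP g₀ os)) ∧
        (∀ (F : T4Family) (θ : Stage13HParams F N) (hP : θ.Provisos₁₃SepCoPH F N) (g₀ : ℕ → ℝ) (os : List (ULoop F)), (rr F θ hP g₀ os).u3.γ = θ.γ)) ↔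
      ∀ (F : T4Family) (θ : Stage13HParams F N) (hP : θ.Provisos₁₃SepCoPH F N), θ.Admissible F N →
        ∃ c ρ : ℝ, NE4OnData (datumOfRecord₁₃SepCoPH F N θ hP) c ρ θ.γ := by
  constructor
  · rintro ⟨rr, hr, hw⟩ F θ hP hθ
    exact (exists_ratesAt_window_iff_n17Free _ _).1 ⟨rr F θ hP (fun _ => 0) [], hr F θ hP hθ _ _, hw F θ hP _ _⟩
  · intro h
    have hne : ∀ (F : T4Family) (θ : Stage13HParams F N) (hP : θ.Provisos₁₃SepCoPH F N),
        ∃ R : RateCarriers N, (θ.Admissible F N → RatesAt (datumOfRecord₁₃SepCoPH F N θ hP) R) ∧ R.u3.γ = θ.γ := by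
      intro F θ hP
      rcases Classical.em (θ.Admissible F N) with hθ | hθ
      · obtain ⟨c, ρ, hc⟩ := h F θ hP hθ
        obtain ⟨R, hγ, hiff⟩ := exists_rateCarriers_window_ratesAt_iff (datumOfRecord₁₃SepCoPH F N θ hP) θ.γ c ρ
        exact ⟨R, fun _ => hiff.2 hc, hγ⟩
      · obtain ⟨R, hγ, -⟩ := exists_rateCarriers_window_ratesAt_iff (datumOfRecord₁₃SepCoPH F N θ hP) θ.γ 0 0
        exact ⟨R, fun h' => absurd h' hθ, hγ⟩
    choose R hR using hne
    exact ⟨fun F θ hP _ _ => R F θ hP, fun F θ hP hθ _ _ => (hR F θ hP).1 hθ, fun F θ hP _ _ => (hR F θ hP).2⟩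

end Keyed

/-! ## §2 «N17 with free letters at the ⁷ record» in β-of-record words; the ⁷ provisos and history slots are not read -/

section BetaWords

variable {F : T4Family} {N : ℕ} [NeZero N]

/-- At a ⁷ tuple with provisos, N17 ON THE DATUM at letters `(c, ρ, γ)` IS the scale-shift bound for def-T's `betaOfRecord₁₃` at the parent view `θ.toStage13Params`
(`NE4OnData D c ρ γ := ScaleShiftRate c ρ γ D.βfun` and `Node00.βfun_datumOfRecord₁₃SepCoPH`, both `rfl`). [cite: Balaban1987RG1, (1.20)-(1.22) p.264] -/
theorem ne4OnData_datumOfRecord₁₃SepCoPH_iff (θ : Stage13HParams F N) (hP : θ.Provisos₁₃SepCoPH F N) (c ρ γ : ℝ) :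
    NE4OnData (datumOfRecord₁₃SepCoPH F N θ hP) c ρ γ ↔ ScaleShiftRate c ρ γ (betaOfRecord₁₃ F N θ.toStage13Params) :=
  Iff.rfl

/-- The free form at a ⁷ tuple ↔ «∃ c ρ, `ScaleShiftRate c ρ θ.γ (betaOfRecord₁₃ F N θ.toStage13Params)`» (`Iff.rfl`). [cite: Balaban1987RG1, (1.20)-(1.22) p.264] -/
theorem n17Free₁₃SepCoPH_iff_betaOfRecord₁₃ (θ : Stage13HParams F N) (hP : θ.Provisos₁₃SepCoPH F N) :
    (∃ c ρ : ℝ, NE4OnData (datumOfRecord₁₃SepCoPH F N θ hP) c ρ θ.γ) ↔ ∃ c ρ : ℝ, ScaleShiftRate c ρ θ.γ (betaOfRecord₁₃ F N θ.toStage13Params) :=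
  Iff.rfl

/-- **THE ⁷ RE-KEY DOES NOT TOUCH N17's SENTENCE**: the proviso-free ‴ sentence over def-T's `Stage13Params` («∀ admissible θ′, ∃ c ρ, `ScaleShiftRate c ρ θ′.γ (betaOfRecord₁₃ F N θ′)`»)
gives the free form at every ⁷ tuple (pull back along `θ.toStage13Params`; `hP`, `Zh`, `Phih`, `Zr` unread). [bookkeeping] -/
theorem n17Free₁₃SepCoPH_of_stage13
    (h : ∀ (F : T4Family) (θ' : Stage13Params F N), θ'.Admissible F N → ∃ c ρ : ℝ, ScaleShiftRate c ρ θ'.γ (betaOfRecord₁₃ F N θ'))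
    (F : T4Family) (θ : Stage13HParams F N) (hP : θ.Provisos₁₃SepCoPH F N) (hθ : θ.Admissible F N) :
    ∃ c ρ : ℝ, NE4OnData (datumOfRecord₁₃SepCoPH F N θ hP) c ρ θ.γ :=
  h F θ.toStage13Params hθ

end BetaWords

/-! ## §3 The headline at `N = 2`: `stub_rates13` (literal shape) from ∕ iff N17's scale-shift sentence for β₁₃, ρ unguarded -/

section Headline

/-- **`stub_rates13` ⟸ N17's SCALE-SHIFT SENTENCE FOR β₁₃, ρ UNGUARDED** (the plan's bookable sentence, W-SEAT-START-LIST v3 §2 n17 item 1): if at every admissible ⁷ tuple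
`θ : Stage13HParams F 2` with provisos SOME bound `|β₁₃(θ)_{k+2}(w) − β₁₃(θ)_{k+1}(tail w)| ≤ c·ρ^k` holds on the boxes `]0, θ.γ]^{k+2}` (ANY `c`, ANY `ρ` — `ρ ≥ 1` allowed), then the
LITERAL TYPE of the K3⁷ v1 stub `∃ rr : RateReading 2, KeyedRates rr ∧ KeyedWindow rr` is inhabited (the K3⁷ line closes `stub_rates13` from this by `exact`).  The witness reading is
§1's letter-degenerate one: this books N17's sentence and NOTHING of N14 ∕ N15 ∕ N16 ∕ N18 ∕ N22.  Hypothesis UNPRINTED and unproved (NE4). [cite: Balaban1987RG1, (1.20)-(1.22) p.264] -/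
theorem stub_rates13_of_scaleShift
    (h : ∀ (F : T4Family) (θ : Stage13HParams F 2) (_hP : θ.Provisos₁₃SepCoPH F 2), θ.Admissible F 2 →
      ∃ c ρ : ℝ, ScaleShiftRate c ρ θ.γ (betaOfRecord₁₃ F 2 θ.toStage13Params)) :
    ∃ rr : (F : T4Family) → (θ : Stage13HParams F 2) → θ.Provisos₁₃SepCoPH F 2 → (ℕ → ℝ) → List (ULoop F) → RateCarriers 2,
      (∀ (F : T4Family) (θ : Stage13HParams F 2) (hP : θ.Provisos₁₃SepCoPH F 2), θ.Admissible F 2 → ∀ (g₀ : ℕ → ℝ) (os : List (ULoop F)),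
          RatesAt (datumOfRecord₁₃SepCoPH F 2 θ hP) (rr F θ hP g₀ os)) ∧
      (∀ (F : T4Family) (θ : Stage13HParams F 2) (hP : θ.Provisos₁₃SepCoPH F 2) (g₀ : ℕ → ℝ) (os : List (ULoop F)), (rr F θ hP g₀ os).u3.γ = θ.γ) :=
  exists_keyedRatesWindow₁₃SepCoPH_iff_n17Free.2 h

/-- **CONVERSELY, `stub_rates13` HANDS THE DATUM NOTHING BUT THAT SENTENCE**: from the literal type of the stub, at every admissible ⁷ tuple ∃ c ρ with the β₁₃ scale-shift
bound (read the N17 conjunct at `(g₀, os) := (0, [])`; the window clause names `θ.γ`). [cite: Balaban1987RG1, (1.20)-(1.22) p.264] -/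
theorem scaleShift_of_stub_rates13
    (h : ∃ rr : (F : T4Family) → (θ : Stage13HParams F 2) → θ.Provisos₁₃SepCoPH F 2 → (ℕ → ℝ) → List (ULoop F) → RateCarriers 2,
      (∀ (F : T4Family) (θ : Stage13HParams F 2) (hP : θ.Provisos₁₃SepCoPH F 2), θ.Admissible F 2 → ∀ (g₀ : ℕ → ℝ) (os : List (ULoop F)),
          RatesAt (datumOfRecord₁₃SepCoPH F 2 θ hP) (rr F θ hP g₀ os)) ∧
      (∀ (F : T4Family) (θ : Stage13HParams F 2) (hP : θ.Provisos₁₃SepCoPH F 2) (g₀ : ℕ → ℝ) (os : List (ULoop F)), (rr F θ hP g₀ os).u3.γ = θ.γ))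
    (F : T4Family) (θ : Stage13HParams F 2) (hP : θ.Provisos₁₃SepCoPH F 2) (hθ : θ.Admissible F 2) :
    ∃ c ρ : ℝ, ScaleShiftRate c ρ θ.γ (betaOfRecord₁₃ F 2 θ.toStage13Params) :=
  exists_keyedRatesWindow₁₃SepCoPH_iff_n17Free.1 h F θ hP hθ

/-- **THE BOOKING RULE AS A KERNEL `iff`** (plan g77: «a by-name close of `stub_rates13` = N17's scale-shift sentence only»): the literal type of the K3⁷ v1 stub ⟺
«∀ admissible ⁷ tuples, ∃ c ρ, `ScaleShiftRate c ρ θ.γ (betaOfRecord₁₃ F 2 θ.toStage13Params)`» — a rate-free shadow of NE4 (no `ρ < 1`), nothing more and nothing less.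
[cite: Balaban1987RG1, (1.20)-(1.22) p.264] -/
theorem stub_rates13_iff_scaleShift :
    (∃ rr : (F : T4Family) → (θ : Stage13HParams F 2) → θ.Provisos₁₃SepCoPH F 2 → (ℕ → ℝ) → List (ULoop F) → RateCarriers 2,
        (∀ (F : T4Family) (θ : Stage13HParams F 2) (hP : θ.Provisos₁₃SepCoPH F 2), θ.Admissible F 2 → ∀ (g₀ : ℕ → ℝ) (os : List (ULoop F)),
            RatesAt (datumOfRecord₁₃SepCoPH F 2 θ hP) (rr F θ hP g₀ os)) ∧
        (∀ (F : T4Family) (θ : Stage13HParams F 2) (hP : θ.Provisos₁₃SepCoPH F 2) (g₀ : ℕ → ℝ) (os : List (ULoop F)), (rr F θ hP g₀ os).u3.γ = θ.γ)) ↔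
      ∀ (F : T4Family) (θ : Stage13HParams F 2) (_hP : θ.Provisos₁₃SepCoPH F 2), θ.Admissible F 2 →
        ∃ c ρ : ℝ, ScaleShiftRate c ρ θ.γ (betaOfRecord₁₃ F 2 θ.toStage13Params) :=
  exists_keyedRatesWindow₁₃SepCoPH_iff_n17Free

/-- **THE `ρ = 1` INSTANCE: BOUNDED β₁₃-SHIFTS ON THE RECORD BOXES ALREADY CLOSE `stub_rates13`** (dag-n18-e evidence #5's `stub_rates13_of_bounded_shifts`, now at a tree
statement): one bound `B` per admissible ⁷ tuple with `|β₁₃_{k+2}(w) − β₁₃_{k+1}(tail w)| ≤ B` for all `k` and all `w ∈ ]0, θ.γ]^{k+2}` suffices (`c := B`, `ρ := 1`).  What free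
letters buy is a SIZE statement, not NE4's η-DECAY. [cite: Balaban1987RG1, (1.20)-(1.22) p.264] -/
theorem stub_rates13_of_bounded_shifts
    (h : ∀ (F : T4Family) (θ : Stage13HParams F 2) (_hP : θ.Provisos₁₃SepCoPH F 2), θ.Admissible F 2 → ∃ B : ℝ,
      ∀ (k : ℕ) (w : Fin (k + 2) → ℝ), w ∈ Box θ.γ (k + 1) →
        |betaOfRecord₁₃ F 2 θ.toStage13Params (k + 1) w - betaOfRecord₁₃ F 2 θ.toStage13Params k (Fin.tail w)| ≤ B) :
    ∃ rr : (F : T4Family) → (θ : Stage13HParams F 2) → θ.Provisos₁₃SepCoPH F 2 → (ℕ → ℝ) → List (ULoop F) → RateCarriers 2,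
      (∀ (F : T4Family) (θ : Stage13HParams F 2) (hP : θ.Provisos₁₃SepCoPH F 2), θ.Admissible F 2 → ∀ (g₀ : ℕ → ℝ) (os : List (ULoop F)),
          RatesAt (datumOfRecord₁₃SepCoPH F 2 θ hP) (rr F θ hP g₀ os)) ∧
      (∀ (F : T4Family) (θ : Stage13HParams F 2) (hP : θ.Provisos₁₃SepCoPH F 2) (g₀ : ℕ → ℝ) (os : List (ULoop F)), (rr F θ hP g₀ os).u3.γ = θ.γ) := by
  refine stub_rates13_of_scaleShift fun F θ hP hθ => ?_
  obtain ⟨B, hB⟩ := h F θ hP hθ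
  exact ⟨B, 1, fun k w hw => by simpa only [one_pow, mul_one] using hB k w hw⟩

/-- **ANY GEOMETRIC GROWTH BOUND CLOSES `stub_rates13`**: `|β₁₃(θ)_{k+1}(v)| ≤ M·A^k` on the boxes `]0, θ.γ]^{k+1}` with `M ≥ 0`, `A ≥ 1` per admissible ⁷ tuple ⟹ the stub
(companion 17's `scaleShiftRate_of_absBound`: `ScaleShiftRate (2MA) A θ.γ β₁₃`).  Free letters are bought by GROWTH; N17 proper (decay, `ρ < 1`) is not what v1's stub 1 books.
[cite: Balaban1987RG1, (1.20)-(1.22) p.264] -/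
theorem stub_rates13_of_absBound
    (h : ∀ (F : T4Family) (θ : Stage13HParams F 2) (_hP : θ.Provisos₁₃SepCoPH F 2), θ.Admissible F 2 → ∃ M A : ℝ, 0 ≤ M ∧ 1 ≤ A ∧
      ∀ (k : ℕ) (v : Fin (k + 1) → ℝ), v ∈ Box θ.γ k → |betaOfRecord₁₃ F 2 θ.toStage13Params k v| ≤ M * A ^ k) :
    ∃ rr : (F : T4Family) → (θ : Stage13HParams F 2) → θ.Provisos₁₃SepCoPH F 2 → (ℕ → ℝ) → List (ULoop F) → RateCarriers 2,
      (∀ (F : T4Family) (θ : Stage13HParams F 2) (hP : θ.Provisos₁₃SepCoPH F 2), θ.Admissible F 2 → ∀ (g₀ : ℕ → ℝ) (os : List (ULoop F)),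
          RatesAt (datumOfRecord₁₃SepCoPH F 2 θ hP) (rr F θ hP g₀ os)) ∧
      (∀ (F : T4Family) (θ : Stage13HParams F 2) (hP : θ.Provisos₁₃SepCoPH F 2) (g₀ : ℕ → ℝ) (os : List (ULoop F)), (rr F θ hP g₀ os).u3.γ = θ.γ) := by
  refine stub_rates13_of_scaleShift fun F θ hP hθ => ?_
  obtain ⟨M, A, hM, hA, hMA⟩ := h F θ hP hθ
  exact ⟨_, _, scaleShiftRate_of_absBound hM hA hMA⟩

/-- **… AND THE PROVISO-FREE ‴ SENTENCE CLOSES IT TOO** (§2's `n17Free₁₃SepCoPH_of_stage13` at `N = 2`): N17's scale-shift sentence stated once over def-T's `Stage13Params`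
(no ⁷ provisos, no history slots) ⟹ the literal type of the K3⁷ v1 stub. [cite: Balaban1987RG1, (1.20)-(1.22) p.264] -/
theorem stub_rates13_of_scaleShift_stage13
    (h : ∀ (F : T4Family) (θ' : Stage13Params F 2), θ'.Admissible F 2 → ∃ c ρ : ℝ, ScaleShiftRate c ρ θ'.γ (betaOfRecord₁₃ F 2 θ'))
    : ∃ rr : (F : T4Family) → (θ : Stage13HParams F 2) → θ.Provisos₁₃SepCoPH F 2 → (ℕ → ℝ) → List (ULoop F) → RateCarriers 2,
      (∀ (F : T4Family) (θ : Stage13HParams F 2) (hP : θ.Provisos₁₃SepCoPH F 2), θ.Admissible F 2 → ∀ (g₀ : ℕ → ℝ) (os : List (ULoop F)),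
          RatesAt (datumOfRecord₁₃SepCoPH F 2 θ hP) (rr F θ hP g₀ os)) ∧
      (∀ (F : T4Family) (θ : Stage13HParams F 2) (hP : θ.Provisos₁₃SepCoPH F 2) (g₀ : ℕ → ℝ) (os : List (ULoop F)), (rr F θ hP g₀ os).u3.γ = θ.γ) :=
  stub_rates13_of_scaleShift fun F θ hP hθ => n17Free₁₃SepCoPH_of_stage13 h F θ hP hθ

end Headline

/-! ## §4 The CoPH-home door: the literal shape at def-T's CORE keys restricts to the ⁷ (`SepCoPH`) shape -/

section CoPHDoor

variable {N : ℕ} [NeZero N]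

/-- **THE CORE-KEYED SHAPE GIVES THE ⁷ SHAPE** (restriction along `Provisos₁₃SepCoPH.toCore`; `datumOfRecord₁₃SepCoPH F N θ hP = datumOfRecord₁₃CoPH F N θ hP.toCore` is def-T's
`datumOfRecord₁₃SepCoPH_eq_coPH`, `rfl`): a single-bundle tuple reading keyed by the CORE provisos `Provisos₁₃CoPH` with the six rates on `datumOfRecord₁₃CoPH` at every admissible
tuple and window `θ.γ` — the conclusion of dag-n22-e's `YMDAG.UVSplit.exists_keyedRates_window_of_k4_rRec₁₃CoPHOn_true` ∕ `…_glueN17` (the six ∕ five-plus-(D4) K4 stubs at a NAMED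
reading of record `𝔯`) — yields the literal type of K3⁷'s `stub_rates13` (the ⁷ provisos only SHRINK the tuple range).  This is the HONEST road into stub 1: rates at the record's
own objects, not at letter-degenerate carriers. [bookkeeping] -/
theorem exists_keyedRatesWindow₁₃SepCoPH_of_coPH
    (h : ∃ rr : (F : T4Family) → (θ : Stage13HParams F N) → θ.Provisos₁₃CoPH F N → (ℕ → ℝ) → List (ULoop F) → RateCarriers N,
      (∀ (F : T4Family) (θ : Stage13HParams F N) (hP : θ.Provisos₁₃CoPH F N), θ.Admissible F N → ∀ (g₀ : ℕ → ℝ) (os : List (ULoop F)),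
          RatesAt (datumOfRecord₁₃CoPH F N θ hP) (rr F θ hP g₀ os)) ∧
        ∀ (F : T4Family) (θ : Stage13HParams F N) (hP : θ.Provisos₁₃CoPH F N) (g₀ : ℕ → ℝ) (os : List (ULoop F)), (rr F θ hP g₀ os).u3.γ = θ.γ) :
    ∃ rr : (F : T4Family) → (θ : Stage13HParams F N) → θ.Provisos₁₃SepCoPH F N → (ℕ → ℝ) → List (ULoop F) → RateCarriers N,
      (∀ (F : T4Family) (θ : Stage13HParams F N) (hP : θ.Provisos₁₃SepCoPH F N), θ.Admissible F N → ∀ (g₀ : ℕ → ℝ) (os : List (ULoop F)),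
          RatesAt (datumOfRecord₁₃SepCoPH F N θ hP) (rr F θ hP g₀ os)) ∧
      (∀ (F : T4Family) (θ : Stage13HParams F N) (hP : θ.Provisos₁₃SepCoPH F N) (g₀ : ℕ → ℝ) (os : List (ULoop F)), (rr F θ hP g₀ os).u3.γ = θ.γ) := by
  obtain ⟨rr, hr, hw⟩ := h
  exact ⟨fun F θ hP g₀ os => rr F θ hP.toCore g₀ os, fun F θ hP hθ g₀ os => hr F θ hP.toCore hθ g₀ os, fun F θ hP g₀ os => hw F θ hP.toCore g₀ os⟩

/-- **… so «N17 with free letters» at the CORE record gives it at the ⁷ record** (same restriction, through §1 both ways round is not needed: directly, the datum is the same). [bookkeeping] -/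
theorem n17Free₁₃SepCoPH_of_coPH
    (h : ∀ (F : T4Family) (θ : Stage13HParams F N) (hP : θ.Provisos₁₃CoPH F N), θ.Admissible F N → ∃ c ρ : ℝ, NE4OnData (datumOfRecord₁₃CoPH F N θ hP) c ρ θ.γ)
    (F : T4Family) (θ : Stage13HParams F N) (hP : θ.Provisos₁₃SepCoPH F N) (hθ : θ.Admissible F N) :
    ∃ c ρ : ℝ, NE4OnData (datumOfRecord₁₃SepCoPH F N θ hP) c ρ θ.γ :=
  h F θ hP.toCore hθ

end CoPHDoor


/-! ## §5 (v1.1) Given stub 1's content, the literal shape of `stub_expansion13` never reads the rates; the whole v1 cut read exactly at ⁷ -/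

section Expansion

variable {N : ℕ} [NeZero N]

open Summit.QuantumFields.BalabanUV.T4Continuum.Spine (NE7.Core)
open YMDAG.UVSplit (SpineCarriers)

/-- **STUB 2 OF K3⁷ v1 IS ITS RATE-FREE VERSION, GIVEN STUB 1's CONTENT** (kernel `iff`, general `N`; the three `rr`-free conjuncts `KeyedRelWeight` ∕ `KeyedShellWeight` ∕
`KeyedExtraction` enter as arbitrary predicates `P₁ P₂ P₃` on spine readings, `KeyedCoreEdge cr rr` is written out at the ⁷ keys): under «N17 with free letters at the ⁷
record», `(∀ rr, KeyedRates rr → KeyedWindow rr → ∃ cr, P₁ cr ∧ P₂ cr ∧ P₃ cr ∧ KeyedCoreEdge cr rr)` holds IFF `∃ cr, P₁ cr ∧ P₂ cr ∧ P₃ cr ∧` the NE7 core two-run matching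
with some summable `δ` at every admissible ⁷ tuple WITH NO RATE ANTECEDENT.  (→) instantiate the `∀ rr` at §1's letter-degenerate reading, whose `RatesAt` antecedent is TRUE;
(←) discard the antecedent.  The ⁷ image of companion 17's `forall_keyedRates₁₂_imp_iff_rateFree`. [bookkeeping] -/
theorem forall_keyedRates₁₃SepCoPH_imp_iff_rateFree
    (hfree : ∀ (F : T4Family) (θ : Stage13HParams F N) (hP : θ.Provisos₁₃SepCoPH F N), θ.Admissible F N →
      ∃ c ρ : ℝ, NE4OnData (datumOfRecord₁₃SepCoPH F N θ hP) c ρ θ.γ)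
    (P₁ P₂ P₃ : ((F : T4Family) → (θ : Stage13HParams F N) → θ.Provisos₁₃SepCoPH F N → (ℕ → ℝ) → List (ULoop F) → SpineCarriers) → Prop) :
    (∀ rr : (F : T4Family) → (θ : Stage13HParams F N) → θ.Provisos₁₃SepCoPH F N → (ℕ → ℝ) → List (ULoop F) → RateCarriers N,
        (∀ (F : T4Family) (θ : Stage13HParams F N) (hP : θ.Provisos₁₃SepCoPH F N), θ.Admissible F N → ∀ (g₀ : ℕ → ℝ) (os : List (ULoop F)),
            RatesAt (datumOfRecord₁₃SepCoPH F N θ hP) (rr F θ hP g₀ os)) →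
        (∀ (F : T4Family) (θ : Stage13HParams F N) (hP : θ.Provisos₁₃SepCoPH F N) (g₀ : ℕ → ℝ) (os : List (ULoop F)), (rr F θ hP g₀ os).u3.γ = θ.γ) →
        ∃ cr : (F : T4Family) → (θ : Stage13HParams F N) → θ.Provisos₁₃SepCoPH F N → (ℕ → ℝ) → List (ULoop F) → SpineCarriers,
          P₁ cr ∧ P₂ cr ∧ P₃ cr ∧
          ∀ (F : T4Family) (θ : Stage13HParams F N) (hP : θ.Provisos₁₃SepCoPH F N), θ.Admissible F N → ∀ (g₀ : ℕ → ℝ) (os : List (ULoop F)),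
            RatesAt (datumOfRecord₁₃SepCoPH F N θ hP) (rr F θ hP g₀ os) → letI := (cr F θ hP g₀ os).dec
              ∃ δ : ℕ → ℝ, NE7.Core (cr F θ hP g₀ os).l₀ (cr F θ hP g₀ os).vol (cr F θ hP g₀ os).T (cr F θ hP g₀ os).Bad
                (fun K t τ => (cr F θ hP g₀ os).A K t τ - (cr F θ hP g₀ os).shA K t τ)
                (fun K t τ => (cr F θ hP g₀ os).B K t τ - (cr F θ hP g₀ os).shB K t τ) δ ∧ Summable δ) ↔
      ∃ cr : (F : T4Family) → (θ : Stage13HParams F N) → θ.Provisos₁₃SepCoPH F N → (ℕ → ℝ) → List (ULoop F) → SpineCarriers,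
        P₁ cr ∧ P₂ cr ∧ P₃ cr ∧
        ∀ (F : T4Family) (θ : Stage13HParams F N) (hP : θ.Provisos₁₃SepCoPH F N), θ.Admissible F N → ∀ (g₀ : ℕ → ℝ) (os : List (ULoop F)),
          letI := (cr F θ hP g₀ os).dec
          ∃ δ : ℕ → ℝ, NE7.Core (cr F θ hP g₀ os).l₀ (cr F θ hP g₀ os).vol (cr F θ hP g₀ os).T (cr F θ hP g₀ os).Bad
            (fun K t τ => (cr F θ hP g₀ os).A K t τ - (cr F θ hP g₀ os).shA K t τ)
            (fun K t τ => (cr F θ hP g₀ os).B K t τ - (cr F θ hP g₀ os).shB K t τ) δ ∧ Summable δ := by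
  constructor
  · intro H
    obtain ⟨rr, hr, hw⟩ := (exists_keyedRatesWindow₁₃SepCoPH_iff_n17Free (N := N)).2 hfree
    obtain ⟨cr, h₁, h₂, h₃, hce⟩ := H rr hr hw
    exact ⟨cr, h₁, h₂, h₃, fun F θ hP hθ g₀ os => hce F θ hP hθ g₀ os (hr F θ hP hθ g₀ os)⟩
  · rintro ⟨cr, h₁, h₂, h₃, hcu⟩ rr _ _
    exact ⟨cr, h₁, h₂, h₃, fun F θ hP hθ g₀ os _ => hcu F θ hP hθ g₀ os⟩

/-- **THE v1 CUT OF K3⁷ READ EXACTLY** (kernel `iff`, general `N`): `stub_rates13 ∧ stub_expansion13` (literal shapes at the ⁷ keys; `P₁ P₂ P₃` := `KeyedRelWeight`,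
`KeyedShellWeight`, `KeyedExtraction`) `↔` «N17 with free letters at the ⁷ record» `∧ ∃ cr, P₁ cr ∧ P₂ cr ∧ P₃ cr ∧` the rate-free core matching — the K4 cluster
N14 ∕ N15 ∕ N16 ∕ N18 ∕ N22 is idle in the cut and N17 enters without `ρ < 1`.  Evidence for the planners' v1-versus-v2 decision; K3⁷ itself is neither claimed nor refuted.
The ⁷ image of companion 17's `k3Cut₁₂_iff_n17Free_and_rateFree`. [bookkeeping] -/
theorem k3Cut₁₃SepCoPH_iff_n17Free_and_rateFree
    (P₁ P₂ P₃ : ((F : T4Family) → (θ : Stage13HParams F N) → θ.Provisos₁₃SepCoPH F N → (ℕ → ℝ) → List (ULoop F) → SpineCarriers) → Prop) :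
    ((∃ rr : (F : T4Family) → (θ : Stage13HParams F N) → θ.Provisos₁₃SepCoPH F N → (ℕ → ℝ) → List (ULoop F) → RateCarriers N,
        (∀ (F : T4Family) (θ : Stage13HParams F N) (hP : θ.Provisos₁₃SepCoPH F N), θ.Admissible F N → ∀ (g₀ : ℕ → ℝ) (os : List (ULoop F)),
            RatesAt (datumOfRecord₁₃SepCoPH F N θ hP) (rr F θ hP g₀ os)) ∧
        (∀ (F : T4Family) (θ : Stage13HParams F N) (hP : θ.Provisos₁₃SepCoPH F N) (g₀ : ℕ → ℝ) (os : List (ULoop F)), (rr F θ hP g₀ os).u3.γ = θ.γ)) ∧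
      (∀ rr : (F : T4Family) → (θ : Stage13HParams F N) → θ.Provisos₁₃SepCoPH F N → (ℕ → ℝ) → List (ULoop F) → RateCarriers N,
        (∀ (F : T4Family) (θ : Stage13HParams F N) (hP : θ.Provisos₁₃SepCoPH F N), θ.Admissible F N → ∀ (g₀ : ℕ → ℝ) (os : List (ULoop F)),
            RatesAt (datumOfRecord₁₃SepCoPH F N θ hP) (rr F θ hP g₀ os)) →
        (∀ (F : T4Family) (θ : Stage13HParams F N) (hP : θ.Provisos₁₃SepCoPH F N) (g₀ : ℕ → ℝ) (os : List (ULoop F)), (rr F θ hP g₀ os).u3.γ = θ.γ) →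
        ∃ cr : (F : T4Family) → (θ : Stage13HParams F N) → θ.Provisos₁₃SepCoPH F N → (ℕ → ℝ) → List (ULoop F) → SpineCarriers,
          P₁ cr ∧ P₂ cr ∧ P₃ cr ∧
          ∀ (F : T4Family) (θ : Stage13HParams F N) (hP : θ.Provisos₁₃SepCoPH F N), θ.Admissible F N → ∀ (g₀ : ℕ → ℝ) (os : List (ULoop F)),
            RatesAt (datumOfRecord₁₃SepCoPH F N θ hP) (rr F θ hP g₀ os) → letI := (cr F θ hP g₀ os).dec
              ∃ δ : ℕ → ℝ, NE7.Core (cr F θ hP g₀ os).l₀ (cr F θ hP g₀ os).vol (cr F θ hP g₀ os).T (cr F θ hP g₀ os).Bad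
                (fun K t τ => (cr F θ hP g₀ os).A K t τ - (cr F θ hP g₀ os).shA K t τ)
                (fun K t τ => (cr F θ hP g₀ os).B K t τ - (cr F θ hP g₀ os).shB K t τ) δ ∧ Summable δ)) ↔
      (∀ (F : T4Family) (θ : Stage13HParams F N) (hP : θ.Provisos₁₃SepCoPH F N), θ.Admissible F N →
          ∃ c ρ : ℝ, NE4OnData (datumOfRecord₁₃SepCoPH F N θ hP) c ρ θ.γ) ∧
        ∃ cr : (F : T4Family) → (θ : Stage13HParams F N) → θ.Provisos₁₃SepCoPH F N → (ℕ → ℝ) → List (ULoop F) → SpineCarriers,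
          P₁ cr ∧ P₂ cr ∧ P₃ cr ∧
          ∀ (F : T4Family) (θ : Stage13HParams F N) (hP : θ.Provisos₁₃SepCoPH F N), θ.Admissible F N → ∀ (g₀ : ℕ → ℝ) (os : List (ULoop F)),
            letI := (cr F θ hP g₀ os).dec
            ∃ δ : ℕ → ℝ, NE7.Core (cr F θ hP g₀ os).l₀ (cr F θ hP g₀ os).vol (cr F θ hP g₀ os).T (cr F θ hP g₀ os).Bad
              (fun K t τ => (cr F θ hP g₀ os).A K t τ - (cr F θ hP g₀ os).shA K t τ)
              (fun K t τ => (cr F θ hP g₀ os).B K t τ - (cr F θ hP g₀ os).shB K t τ) δ ∧ Summable δ := by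
  constructor
  · rintro ⟨h₁, h₂⟩
    have hfree := (exists_keyedRatesWindow₁₃SepCoPH_iff_n17Free (N := N)).1 h₁
    exact ⟨hfree, (forall_keyedRates₁₃SepCoPH_imp_iff_rateFree hfree P₁ P₂ P₃).1 h₂⟩
  · rintro ⟨hfree, h⟩
    exact ⟨(exists_keyedRatesWindow₁₃SepCoPH_iff_n17Free (N := N)).2 hfree, (forall_keyedRates₁₃SepCoPH_imp_iff_rateFree hfree P₁ P₂ P₃).2 h⟩

end Expansion

end Summit.QuantumFields.YangMills.Theorems.BalabanUVNodesK3Stub1OfScaleShift
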